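import Literature.AlgebraicGeometry.Limits.SubalgebraDiagram
import Literature.AlgebraicGeometry.Modules.DetClassOfIso
import Literature.AlgebraicGeometry.Modules.PullbackFrame
import Mathlib.AlgebraicGeometry.Morphisms.UniversallyOpen
import HarnessLib

/-!
# The rank of a finite locally free module is detected after a dominant pull-back

Topic: `Literature/AlgebraicGeometry/Limits` (Noetherian approximation, EGA IV₃ §8.5; The Stacks Project
Tag 0B8W). When a finite locally free module `E` on the limit `Spec B ×_K P = lim (Spec K[t] ×_K P)` is
descended to a finite locally free module `ℰ` on a stage (Stacks 0B8W (1), ★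
`Limits/FiniteLocallyFreeSubalgebraDescent`), the RANK of `ℰ` is a priori only controlled over the image
of the limit. This file records the missing half for CONSTANT rank: if `π : X → Y` has DENSE image and
`π^* ℰ` has constant rank `r`, then the finite locally free `ℰ` has constant rank `r` on all of `Y`
(`hasRank_of_hasRank_pullback_of_denseRange`: every local frame of `ℰ` lives on an open meeting the image,
where its pull-back is compared with a rank-`r` frame — ★ `Modules.rank_eq_of_nontrivial`), and that the
legs `P ×_K Spec B → P ×_K Spec K[t]` of ★ `SubalgApprox.prodCone` have dense image when `P → Spec K` is
universally open (e.g. smooth) — the base change of the dominant `Spec B → Spec K[t]` (`K[t] ⊆ B`) along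
an open map (`denseRange_of_isPullback`, `SubalgApprox.denseRange_prodCone_π_app`).

* `denseRange_of_isPullback` — in a cartesian square of schemes whose right leg is an open map, a dense
  bottom arrow has a dense top arrow (Mathlib `Scheme.Pullback.range_fst`, `Dense.preimage`);
* `denseRange_specMap_of_injective` — `Spec B → Spec A` is dominant for `A ↪ B` (Stacks 00FL);
* `SubalgApprox.denseRange_baseCone_π_app`, `SubalgApprox.denseRange_prodCone_π_app`;
* `hasRank_of_hasRank_pullback_of_denseRange`.

Everything is proved; theorems only; no named facts.

## References

* The Stacks Project, Tag 0B8W (Lemma 32.10.3), Tag 00FL (Lemma 10.30.6), Tag 01C6. [StacksProject]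
* A. Grothendieck, J. Dieudonné, EGA IV₃ (1966), Prop. 8.5.5, Thm. 8.10.5. [EGAIV3]
* U. Görtz, T. Wedhorn, *Algebraic Geometry I*, 2nd ed. (2020), Thm. 10.60, Prop. 10.62. [GortzWedhorn2020]
-/

noncomputable section

universe u

open CategoryTheory CategoryTheory.Limits AlgebraicGeometry TopologicalSpace Opposite MonoidalCategory

namespace Literature.AlgebraicGeometry.Limits

open Literature.AlgebraicGeometry.Motives Literature.AlgebraicGeometry.Modules

/-! ### §1 Dense images under base change by an open map -/

/-- **In a cartesian square whose right leg is an open map, a dominant bottom arrow has a dominant top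
arrow**: `range fst = f ⁻¹ (range g)` (Mathlib `Scheme.Pullback.range_fst`) is the preimage of a dense set
under an open map. [cite: EGAIV3, Thm. 8.10.5 proof / Prop. 2.3.4 (dominance and base change)] [cite: StacksProject, Tag 0CC1] -/
theorem denseRange_of_isPullback {P X Y Z : Scheme.{u}} {fst : P ⟶ X} {snd : P ⟶ Y} {f : X ⟶ Z}
    {g : Y ⟶ Z} (h : IsPullback fst snd f g) (hf : IsOpenMap f.base) (hg : DenseRange g.base) :
    DenseRange fst.base := by
  have hrange : Set.range fst.base = f.base ⁻¹' Set.range g.base := by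
    rw [← h.isoPullback_hom_fst, Scheme.Hom.comp_base, TopCat.coe_comp, Set.range_comp,
      Set.range_eq_univ.mpr h.isoPullback.hom.surjective, Set.image_univ,
      Scheme.Pullback.range_fst]
  change Dense (Set.range fst.base)
  rw [hrange]
  exact hg.preimage hf

/-- **`Spec B → Spec A` has dense image when `A → B` is injective** (the kernel `0` lies in the
nilradical; Mathlib `PrimeSpectrum.denseRange_comap_iff_ker_le_nilRadical`). [cite: StacksProject, Tag 00FL (Lemma 10.30.6)] -/
theorem denseRange_specMap_of_injective {A B : CommRingCat.{u}} (φ : A ⟶ B)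
    (hφ : Function.Injective φ.hom) : DenseRange (Spec.map φ).base := by
  have h : DenseRange (PrimeSpectrum.comap φ.hom) := by
    rw [PrimeSpectrum.denseRange_comap_iff_ker_le_nilRadical, (RingHom.injective_iff_ker_eq_bot φ.hom).1 hφ]
    exact bot_le
  intro x
  exact h x

namespace SubalgApprox

variable (K : Type u) (B : Type u) [CommRing K] [CommRing B] [Algebra K B] (s₁ : Finset B)

/-- **The legs `Spec B → Spec K[t]` of ★ `baseCone` have dense image** (`K[t] ⊆ B`).
[cite: StacksProject, Tag 00FL (Lemma 10.30.6)] [cite: GortzWedhorn2020, (10.13), p. 321] -/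
theorem denseRange_baseCone_π_app (t : (Idx B s₁)ᵒᵖ) :
    DenseRange ((baseCone K B s₁).π.app t).left.base := by
  rw [baseCone_π_app_left]
  exact denseRange_specMap_of_injective _ Subtype.val_injective

/-- **The legs `P ×_K Spec B → P ×_K Spec K[t]` of ★ `prodCone` have dense image when `P → Spec K` is
universally open** (e.g. smooth; the square ★ `isPullback_whiskerLeft_left` is cartesian with open right
leg `P ×_K Spec K[t] → Spec K[t]`). [cite: EGAIV3, Thm. 8.10.5] [cite: StacksProject, Tag 0B8W] -/
theorem denseRange_prodCone_π_app (P : SchemeOver K) [UniversallyOpen P.hom] (t : (Idx B s₁)ᵒᵖ) :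
    DenseRange ((prodCone K B s₁ P).π.app t).base := by
  rw [prodCone_π_app]
  haveI : UniversallyOpen (pullback.snd P.hom ((baseDiagram K B s₁).obj t).hom) := inferInstance
  exact denseRange_of_isPullback (isPullback_whiskerLeft_left P ((baseCone K B s₁).π.app t))
    (pullback.snd P.hom ((baseDiagram K B s₁).obj t).hom).isOpenMap (denseRange_baseCone_π_app K B s₁ t)

end SubalgApprox

/-! ### §2 Constant rank is detected after a dominant pull-back -/

/-- **A finite locally free module whose pull-back along a morphism with dense image has constant rank
`r` has constant rank `r`**: every local frame `𝒪^I ≅ ℰ|_U` (`U ∋ y` open, hence meeting the image) pulls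
back to a frame of `π^* ℰ` over the non-empty `π⁻¹ U` (★ `pullbackFrame`), where `π^* ℰ` also has a frame of
size `r`; two frames over a non-empty open have the same size (★ `rank_eq_of_nontrivial`).
[cite: StacksProject, Tag 0B8W (Lemma 32.10.3) with Tag 01C6] [cite: GortzWedhorn2020, Prop. 10.62] -/
theorem hasRank_of_hasRank_pullback_of_denseRange {X Y : Scheme.{u}} (π : X ⟶ Y) (hπ : DenseRange π.base)
    {ℰ : Y.Modules} (hℰ : IsFiniteLocallyFree ℰ) {r : ℕ}
    (hr : HasRank ((Scheme.Modules.pullback π).obj ℰ) r) : HasRank ℰ r := by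
  classical
  let F := frameSystemOfIsFiniteLocallyFree hℰ
  obtain ⟨F', hF'⟩ := exists_frameSystem_of_hasRank hr
  refine F.hasRank r fun y => ?_
  -- a point `x` of `X` with `π x ∈ U_y`
  obtain ⟨x, hx⟩ := hπ.exists_mem_open (F.U y).2 ⟨y, F.mem y⟩
  have hxU : x ∈ π ⁻¹ᵁ F.U y := hx
  -- the non-empty open `V = π⁻¹ U_y ∩ U'_x` of `X` and the two frames of `π^* ℰ` over it
  let V : X.Opens := π ⁻¹ᵁ F.U y ⊓ F'.U x
  haveI : Nonempty V := ⟨⟨x, hxU, F'.mem x⟩⟩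
  haveI : Fintype (F.I y) := Fintype.ofEquiv _ (F.enum y).symm
  haveI : Fintype (F'.I x) := Fintype.ofEquiv _ (F'.enum x).symm
  have h := rank_eq_of_nontrivial (pullbackFrame π (F.frame y)) (F'.frame x) (F.enum y) (F'.enum x)
    (Opens.infLELeft _ _ : V ⟶ _) (Opens.infLERight _ _)
  rw [h]
  exact hF' x

end Literature.AlgebraicGeometry.Limits

end
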